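import Summits.QuantumFields.BalabanUV.Beta.D1BFx.ScaleLegTermBound
import Summits.QuantumFields.BalabanUV.Beta.D1BFx.ScaleLegByParts

/-!
# `BalabanUV.Beta.D1BFx.TwoPointTermBound` — road «BF-x» for binder row D1, «A3.c ∕ L-X TAILS» PART II (H): the ADMISSIBLE-TERM BOUND with
# EXPLICIT n-free constants for a weighted located product `P(w)·c·H₁(w+x)·H₂(w+y)` whose legs are given ABSTRACTLY by a far soft row, a
# free + flat window split and an `ℓ¹` envelope — and the summation-by-parts identity in this orientation

HONEST DEPENDENCY (page 1, mandatory): continuum YM on T⁴ ⇐ BetaPertH ∧ nine spine estimates (0/9 proved); BetaPertH ⇐ (D1) ∧ (D4) ∧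
CAP+tail; G-an2-4 gates asym, D1 and NE2/3/4.  HONEST FRAMING (cell contract, verbatim): «discharging `BetaPertH` makes Bałaban's UV
stability UNCONDITIONAL — a real constructive-QFT result; it is NOT the continuum limit and NOT the Clay problem.»  THIS MODULE DISCHARGES
NOTHING of the wall: [folklore] composition BY NAME of part (C1) `ScaleLegTermCount` (the count, the per-point forms), (C2) `ScaleLegTermBound`
(`summable_weighted_of_envelopes`), (C3) `ScaleLegByParts.tsum_byParts`, `WindowIdentification.fullSum_eq_tsum_sub`, through the reflection
`H₁(w + x) = (u ↦ H₁(−u))((−x) − w)`.  `P, H₁, H₂, F_i, Φ_i` are ARBITRARY functions `ℤ⁴ → ℝ`; nothing about Bałaban's kernels is asserted; no `def`,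
no `Prop` minted, nothing cited, 0 sorry.  0 wall binders; NOT an A3.c row, NOT (K), NOT D1, NOT `BetaPertH`, NOT continuum, NOT Clay.

ABSOLUTE RULE (cell charter, verbatim): «No internally-minted statement may enter as a cited fact. Every hypothesis is either kernel-proved in
this package or a verbatim quotation of a PUBLISHED theorem with page reference. The manuscript(s) under audit are NOT citable for their own
disputed steps — they are the thing under adjudication; programme-internal (2001/route/tribunal) claims are never citable.»

WHY (this lineage's N-d1leaf03g12-2, journal l.30261): the two-point terms of part (F3) are, at a fixed base point, products of two ONE-VARIABLE
profiles read at `w + x` and `w + y` (both legs co-moving with the first vertex); their rows (part (G)) come with constants fixed before the scale.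
Part (I) needs the per-term bound with the dependence on those constants EXPLICIT, so that the bound is visibly the same number at every scale.
* §1 [folklore] reflection lemmas; re-oriented per-point forms `abs_weighted_far_le'`, `abs_weighted_window_le'`; `summable_weighted_of_envelopes'`.
* §2 [folklore] **`weighted_term_bound`**: window + tail + count ⇒ `Summable`, `|fullSum| ≤ 80C₁ + 160C₂ + 80Et(1+1/δ)`, `|Σ'| ≤ … + Et` with
  `C₁ = Cp|c|2^m(A₁'D₂ + D₁A₂' + D₁D₂)`, `C₂ = Cp|c|2^m A₁'A₂'`, `Et = Cp|c|B₁'B₂'`, `A_i' = A_i(‖offset‖∞+1)^{q_i}`, `B_i' = B_i e^{δ‖offset‖∞}(‖offset‖∞+1)^{p_i}`.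
* §3 [folklore] **`tsum_byParts'`**: `Σ' Q(w)·c·H₁(w+x)·[H₂(w+y+a) − H₂(w+y)] = Σ' Q(w−a)·c·[H₁(w+x−a) − H₁(w+x)]·H₂(w+y) + Σ' [Q(w−a) − Q(w)]·c·H₁(w+x)·H₂(w+y)`.
Unit `b2b-balaban-beta-d1-formalise-leaf-03` (gen 12), D1 formalisation swarm; `LEAVES-BFx.md` row «A3.c ∕ L-X TAILS» PART II (H).
-/

noncomputable section

namespace Summit.QuantumFields.BalabanUV.Beta.D1BFx.TwoPointTermBound

open Filter Topology
open Literature.Probability.LatticeModels (annulus)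
open Literature.MathematicalPhysics.QuantumFieldTheory.Balaban1983to89
open Literature.MathematicalPhysics.QuantumFieldTheory.Balaban1983to89.Beta
open B12Sec2to5 (l1)
open DyadicShell (Pt supNorm supNorm_eq_zero_iff supNorm_eq_of_mem_sphere)
open WindowIdentification (psum fullSum fullSum_eq_tsum_sub)
open GradedBubbles (supNorm_neg)
open ScaleLegTermCount (abs_weighted_far_le abs_weighted_window_le abs_fullSum_le_of_window_quintic_tail)
open ScaleLegTermBound (summable_weighted_of_envelopes)
open ScaleLegByParts (tsum_byParts)

/-! ## §1 Reflection and the re-oriented per-point forms -/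

section Reflect

variable {n : ℕ} {δ Cp c : ℝ} {m : ℕ} {P H₁ H₂ : Pt → ℝ} {x y : Pt}

/-- [folklore] `H (w + x) = (u ↦ H (−u)) ((−x) − w)`. -/
theorem apply_add_eq_reflect (H : Pt → ℝ) (w x : Pt) : H (w + x) = (fun u => H (-u)) (-x - w) := by
  simp only [neg_sub_left, neg_add_rev, neg_neg]

/-- [folklore] A soft far bound is invariant under reflection. -/
theorem soft_reflect {B : ℝ} {p : ℕ} (h : ∀ u : Pt, |H₁ u| ≤ B * Real.exp (-(δ / n) * supNorm u) / ((supNorm u : ℝ) + 1) ^ p) (u : Pt) :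
    |(fun u => H₁ (-u)) u| ≤ B * Real.exp (-(δ / n) * supNorm u) / ((supNorm u : ℝ) + 1) ^ p := by
  have := h (-u); rwa [supNorm_neg] at this

/-- [folklore] A power bound is invariant under reflection. -/
theorem pow_reflect {A : ℝ} {q : ℕ} {F : Pt → ℝ} (h : ∀ u : Pt, |F u| ≤ A / ((supNorm u : ℝ) + 1) ^ q) (u : Pt) :
    |(fun u => F (-u)) u| ≤ A / ((supNorm u : ℝ) + 1) ^ q := by
  have := h (-u); rwa [supNorm_neg] at this

/-- [folklore] An `ℓ¹` envelope is invariant under reflection. -/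
theorem env_reflect {C δ' : ℝ} (h : ∀ u : Pt, |H₁ u| ≤ C * Real.exp (-δ' * l1 u)) (u : Pt) :
    |(fun u => H₁ (-u)) u| ≤ C * Real.exp (-δ' * l1 u) := by
  -- `|−u|₁ = |u|₁` (the tree's `CrossERest.l1_neg'`, re-derived inline to keep this module's imports light)
  have hl : l1 (-u) = l1 u := by
    unfold B12Sec2to5.l1
    exact Finset.sum_congr rfl fun i _ => by rw [Pi.neg_apply, Int.cast_neg, abs_neg]
  have := h (-u); rwa [hl] at this

/-- [folklore] **THE TAIL FORM, both legs co-moving** (`m + 4 ≤ p₁ + p₂`): for ALL `w`,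
`|P w·c·H₁(w+x)·H₂(w+y)| ≤ [Cp|c|B₁e^{δ‖x‖∞}(‖x‖∞+1)^{p₁}B₂e^{δ‖y‖∞}(‖y‖∞+1)^{p₂}]·e^{−(δ/n)‖w‖∞}/(‖w‖∞+1)⁴`. -/
theorem abs_weighted_far_le' (hn : 1 ≤ n) (hδ : 0 ≤ δ) (hCp : 0 ≤ Cp) (hP : ∀ w : Pt, |P w| ≤ Cp * ((supNorm w : ℝ) + 1) ^ m)
    {B₁ B₂ : ℝ} (hB₁ : 0 ≤ B₁) (hB₂ : 0 ≤ B₂) {p₁ p₂ : ℕ}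
    (h₁ : ∀ u : Pt, |H₁ u| ≤ B₁ * Real.exp (-(δ / n) * supNorm u) / ((supNorm u : ℝ) + 1) ^ p₁)
    (h₂ : ∀ u : Pt, |H₂ u| ≤ B₂ * Real.exp (-(δ / n) * supNorm u) / ((supNorm u : ℝ) + 1) ^ p₂) (hm : m + 4 ≤ p₁ + p₂) (w : Pt) :
    |P w * (c * (H₁ (w + x) * H₂ (w + y)))| ≤
      Cp * |c| * (B₁ * (Real.exp (δ * supNorm x) * ((supNorm x : ℝ) + 1) ^ p₁)) * (B₂ * (Real.exp (δ * supNorm y) * ((supNorm y : ℝ) + 1) ^ p₂)) *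
        Real.exp (-(δ / n) * supNorm w) / ((supNorm w : ℝ) + 1) ^ 4 := by
  have h := abs_weighted_far_le (H₁ := fun u => H₁ (-u)) (H₂ := H₂) (x := -x) (y := y) (c := c) hn hδ hCp hP hB₁ hB₂ (soft_reflect h₁) h₂ hm w
  rw [supNorm_neg] at h
  rwa [apply_add_eq_reflect H₁ w x]

/-- [folklore] **THE WINDOW FORM, both legs co-moving** (shell `‖w‖∞ = r+1 ≤ n`; split `H_i = F_i + Φ_i`; exponents as in part (C1)). -/
theorem abs_weighted_window_le' (hn : 1 ≤ n) (hCp : 0 ≤ Cp) (hP : ∀ w : Pt, |P w| ≤ Cp * ((supNorm w : ℝ) + 1) ^ m)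
    {F₁ Φ₁ F₂ Φ₂ : Pt → ℝ} (hH₁ : ∀ u, H₁ u = F₁ u + Φ₁ u) (hH₂ : ∀ u, H₂ u = F₂ u + Φ₂ u)
    {A₁ A₂ D₁ D₂ : ℝ} (hA₁ : 0 ≤ A₁) (hA₂ : 0 ≤ A₂) (hD₁ : 0 ≤ D₁) (hD₂ : 0 ≤ D₂) {q₁ q₂ p₁ p₂ : ℕ}
    (hF₁ : ∀ u : Pt, |F₁ u| ≤ A₁ / ((supNorm u : ℝ) + 1) ^ q₁) (hF₂ : ∀ u : Pt, |F₂ u| ≤ A₂ / ((supNorm u : ℝ) + 1) ^ q₂)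
    (hΦ₁ : ∀ u : Pt, |Φ₁ u| ≤ D₁ / (n : ℝ) ^ p₁) (hΦ₂ : ∀ u : Pt, |Φ₂ u| ≤ D₂ / (n : ℝ) ^ p₂)
    (hqq : m + 5 ≤ q₁ + q₂) (hqp : m + 4 ≤ q₁ + p₂) (hpq : m + 4 ≤ p₁ + q₂) (hpp : m + 4 ≤ p₁ + p₂) (hp₁ : 1 ≤ p₁) (hp₂ : 1 ≤ p₂)
    {r : ℕ} (hr : r + 1 ≤ n) {w : Pt} (hw : w ∈ annulus 4 r (r + 1)) :
    |P w * (c * (H₁ (w + x) * H₂ (w + y)))| ≤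
      Cp * |c| * 2 ^ m * (A₁ * ((supNorm x : ℝ) + 1) ^ q₁ * D₂ + D₁ * (A₂ * ((supNorm y : ℝ) + 1) ^ q₂) + D₁ * D₂) / (((r : ℝ) + 1) ^ 3 * (n : ℝ))
      + Cp * |c| * 2 ^ m * (A₁ * ((supNorm x : ℝ) + 1) ^ q₁ * (A₂ * ((supNorm y : ℝ) + 1) ^ q₂)) / ((r : ℝ) + 1) ^ 5 := by
  have h := abs_weighted_window_le (H₁ := fun u => H₁ (-u)) (H₂ := H₂) (x := -x) (y := y) (c := c) hn hCp hP
    (F₁ := fun u => F₁ (-u)) (Φ₁ := fun u => Φ₁ (-u)) (F₂ := F₂) (Φ₂ := Φ₂) (fun u => hH₁ (-u)) hH₂ hA₁ hA₂ hD₁ hD₂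
    (pow_reflect hF₁) hF₂ (fun u => hΦ₁ (-u)) hΦ₂ hqq hqp hpq hpp hp₁ hp₂ hr hw
  rw [supNorm_neg] at h
  rwa [apply_add_eq_reflect H₁ w x]

/-- [folklore] **SUMMABILITY, both legs co-moving**, from `ℓ¹` envelopes and a weight of degree `≤ 2`. -/
theorem summable_weighted_of_envelopes' {C₁ C₂ δ' : ℝ} (hδ' : 0 < δ') (hP : ∀ w : Pt, |P w| ≤ Cp * ((supNorm w : ℝ) + 1) ^ m) (hm : m ≤ 2)
    (h₁ : ∀ u : Pt, |H₁ u| ≤ C₁ * Real.exp (-δ' * l1 u)) (h₂ : ∀ u : Pt, |H₂ u| ≤ C₂ * Real.exp (-δ' * l1 u)) :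
    Summable (fun w : Pt => P w * (c * (H₁ (w + x) * H₂ (w + y)))) := by
  have h := summable_weighted_of_envelopes (H₁ := fun u => H₁ (-u)) (H₂ := H₂) (x := -x) (y := y) (c := c) hδ' hP hm (env_reflect h₁) h₂
  refine h.congr fun w => ?_
  rw [show -(-x - w) = w + x by abel]

end Reflect

/-! ## §2 The admissible-term bound with explicit constants -/

section Bound

variable {n : ℕ} {δ Cp c : ℝ} {m : ℕ} {P H₁ H₂ : Pt → ℝ} {x y : Pt}

/-- [folklore] **THE ADMISSIBLE-TERM BOUND, EXPLICIT.**  At a scale `n ≥ 1`, for a weight `|P w| ≤ Cp(‖w‖∞+1)^m` (`m ≤ 2`), legs with far soft rows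
`(B_i, p_i)`, window splits `H_i = F_i + Φ_i` with `|F_i| ≤ A_i/(‖u‖∞+1)^{q_i}`, `|Φ_i| ≤ D_i/n^{p_i}`, exponents satisfying
`m+5 ≤ q₁+q₂`, `m+4 ≤ q₁+p₂`, `m+4 ≤ p₁+q₂`, `m+4 ≤ p₁+p₂`, `1 ≤ p_i`, and `ℓ¹` envelopes (for summability only): `w ↦ P w·c·H₁(w+x)·H₂(w+y)` is
summable, `|fullSum| ≤ 80C₁ + 160C₂ + 80Et(1 + 1/δ)` and `|Σ'| ≤ 80C₁ + 160C₂ + 80Et(1+1/δ) + Et` with the displayed n-free `C₁, C₂, Et`. -/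
theorem weighted_term_bound (hn : 1 ≤ n) (hδ : 0 < δ) (hCp : 0 ≤ Cp) (hP : ∀ w : Pt, |P w| ≤ Cp * ((supNorm w : ℝ) + 1) ^ m) (hm2 : m ≤ 2)
    {F₁ Φ₁ F₂ Φ₂ : Pt → ℝ} (hH₁ : ∀ u, H₁ u = F₁ u + Φ₁ u) (hH₂ : ∀ u, H₂ u = F₂ u + Φ₂ u)
    {B₁ B₂ A₁ A₂ D₁ D₂ : ℝ} (hB₁ : 0 ≤ B₁) (hB₂ : 0 ≤ B₂) (hA₁ : 0 ≤ A₁) (hA₂ : 0 ≤ A₂) (hD₁ : 0 ≤ D₁) (hD₂ : 0 ≤ D₂) {p₁ p₂ q₁ q₂ : ℕ}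
    (far₁ : ∀ u : Pt, |H₁ u| ≤ B₁ * Real.exp (-(δ / n) * supNorm u) / ((supNorm u : ℝ) + 1) ^ p₁)
    (far₂ : ∀ u : Pt, |H₂ u| ≤ B₂ * Real.exp (-(δ / n) * supNorm u) / ((supNorm u : ℝ) + 1) ^ p₂)
    (hF₁ : ∀ u : Pt, |F₁ u| ≤ A₁ / ((supNorm u : ℝ) + 1) ^ q₁) (hF₂ : ∀ u : Pt, |F₂ u| ≤ A₂ / ((supNorm u : ℝ) + 1) ^ q₂)
    (hΦ₁ : ∀ u : Pt, |Φ₁ u| ≤ D₁ / (n : ℝ) ^ p₁) (hΦ₂ : ∀ u : Pt, |Φ₂ u| ≤ D₂ / (n : ℝ) ^ p₂)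
    (hqq : m + 5 ≤ q₁ + q₂) (hqp : m + 4 ≤ q₁ + p₂) (hpq : m + 4 ≤ p₁ + q₂) (hpp : m + 4 ≤ p₁ + p₂) (hp₁ : 1 ≤ p₁) (hp₂ : 1 ≤ p₂)
    {E₁ E₂ δ' : ℝ} (hδ' : 0 < δ') (env₁ : ∀ u : Pt, |H₁ u| ≤ E₁ * Real.exp (-δ' * l1 u)) (env₂ : ∀ u : Pt, |H₂ u| ≤ E₂ * Real.exp (-δ' * l1 u)) :
    Summable (fun w : Pt => P w * (c * (H₁ (w + x) * H₂ (w + y)))) ∧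
    |fullSum (fun w : Pt => P w * (c * (H₁ (w + x) * H₂ (w + y))))| ≤
      80 * (Cp * |c| * 2 ^ m * (A₁ * ((supNorm x : ℝ) + 1) ^ q₁ * D₂ + D₁ * (A₂ * ((supNorm y : ℝ) + 1) ^ q₂) + D₁ * D₂))
      + 160 * (Cp * |c| * 2 ^ m * (A₁ * ((supNorm x : ℝ) + 1) ^ q₁ * (A₂ * ((supNorm y : ℝ) + 1) ^ q₂)))
      + 80 * (Cp * |c| * (B₁ * (Real.exp (δ * supNorm x) * ((supNorm x : ℝ) + 1) ^ p₁)) * (B₂ * (Real.exp (δ * supNorm y) * ((supNorm y : ℝ) + 1) ^ p₂)))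
        * (1 + 1 / δ) ∧
    |∑' w : Pt, P w * (c * (H₁ (w + x) * H₂ (w + y)))| ≤
      80 * (Cp * |c| * 2 ^ m * (A₁ * ((supNorm x : ℝ) + 1) ^ q₁ * D₂ + D₁ * (A₂ * ((supNorm y : ℝ) + 1) ^ q₂) + D₁ * D₂))
      + 160 * (Cp * |c| * 2 ^ m * (A₁ * ((supNorm x : ℝ) + 1) ^ q₁ * (A₂ * ((supNorm y : ℝ) + 1) ^ q₂)))
      + 80 * (Cp * |c| * (B₁ * (Real.exp (δ * supNorm x) * ((supNorm x : ℝ) + 1) ^ p₁)) * (B₂ * (Real.exp (δ * supNorm y) * ((supNorm y : ℝ) + 1) ^ p₂)))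
        * (1 + 1 / δ)
      + Cp * |c| * (B₁ * (Real.exp (δ * supNorm x) * ((supNorm x : ℝ) + 1) ^ p₁)) * (B₂ * (Real.exp (δ * supNorm y) * ((supNorm y : ℝ) + 1) ^ p₂)) := by
  set C₁ : ℝ := Cp * |c| * 2 ^ m * (A₁ * ((supNorm x : ℝ) + 1) ^ q₁ * D₂ + D₁ * (A₂ * ((supNorm y : ℝ) + 1) ^ q₂) + D₁ * D₂) with hC₁
  set C₂ : ℝ := Cp * |c| * 2 ^ m * (A₁ * ((supNorm x : ℝ) + 1) ^ q₁ * (A₂ * ((supNorm y : ℝ) + 1) ^ q₂)) with hC₂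
  set Et : ℝ := Cp * |c| * (B₁ * (Real.exp (δ * supNorm x) * ((supNorm x : ℝ) + 1) ^ p₁)) *
    (B₂ * (Real.exp (δ * supNorm y) * ((supNorm y : ℝ) + 1) ^ p₂)) with hEt
  have hC₁0 : 0 ≤ C₁ := by positivity
  have hC₂0 : 0 ≤ C₂ := by positivity
  have hEt0 : 0 ≤ Et := by positivity
  have hn0 : (0 : ℝ) < n := by exact_mod_cast hn
  -- tail
  have tail : ∀ w : Pt, |P w * (c * (H₁ (w + x) * H₂ (w + y)))| ≤ Et * Real.exp (-(δ / n) * supNorm w) / ((supNorm w : ℝ) + 1) ^ 4 :=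
    fun w => abs_weighted_far_le' hn hδ.le hCp hP hB₁ hB₂ far₁ far₂ hpp w
  have htail : ∀ r : ℕ, n - 1 ≤ r → ∀ w ∈ annulus 4 r (r + 1),
      |P w * (c * (H₁ (w + x) * H₂ (w + y)))| ≤ Et / ((r : ℝ) + 1) ^ 4 * Real.exp (-(δ / (n : ℝ)) * ((r : ℝ) + 1)) := by
    intro r _ w hw
    have hsw : (supNorm w : ℝ) = (r : ℝ) + 1 := by rw [supNorm_eq_of_mem_sphere hw]; push_cast; ring
    refine (tail w).trans ?_
    rw [hsw]
    have hr0 : (0 : ℝ) < (r : ℝ) + 1 := by positivity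
    rw [div_le_iff₀ (by positivity)]
    calc Et * Real.exp (-(δ / n) * ((r : ℝ) + 1)) = Et / ((r : ℝ) + 1) ^ 4 * Real.exp (-(δ / n) * ((r : ℝ) + 1)) * ((r : ℝ) + 1) ^ 4 := by
          field_simp
      _ ≤ Et / ((r : ℝ) + 1) ^ 4 * Real.exp (-(δ / n) * ((r : ℝ) + 1)) * ((r : ℝ) + 1 + 1) ^ 4 := by
          gcongr
          linarith
  -- window
  have hwin : ∀ r : ℕ, r + 1 ≤ n → ∀ w ∈ annulus 4 r (r + 1),
      |P w * (c * (H₁ (w + x) * H₂ (w + y)))| ≤ C₁ / (((r : ℝ) + 1) ^ 3 * (n : ℝ)) + C₂ / ((r : ℝ) + 1) ^ 5 :=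
    fun r hr w hw => abs_weighted_window_le' hn hCp hP hH₁ hH₂ hA₁ hA₂ hD₁ hD₂ hF₁ hF₂ hΦ₁ hΦ₂ hqq hqp hpq hpp hp₁ hp₂ hr hw
  have hfull := abs_fullSum_le_of_window_quintic_tail hn hC₁0 hC₂0 hEt0 hδ hwin htail
  have hsum : Summable (fun w : Pt => P w * (c * (H₁ (w + x) * H₂ (w + y)))) := summable_weighted_of_envelopes' hδ' hP hm2 env₁ env₂
  have h0v : |P 0 * (c * (H₁ (0 + x) * H₂ (0 + y)))| ≤ Et := by
    refine (tail 0).trans ?_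
    have hs : (supNorm (0 : Pt) : ℝ) = 0 := by exact_mod_cast supNorm_eq_zero_iff.mpr rfl
    rw [hs, mul_zero, Real.exp_zero, zero_add, one_pow, mul_one, div_one]
  refine ⟨hsum, hfull, ?_⟩
  rw [show (∑' w : Pt, P w * (c * (H₁ (w + x) * H₂ (w + y)))) =
      fullSum (fun w : Pt => P w * (c * (H₁ (w + x) * H₂ (w + y)))) + P 0 * (c * (H₁ (0 + x) * H₂ (0 + y))) by
    rw [fullSum_eq_tsum_sub _ hsum]; ring]
  exact (abs_add_le _ _).trans (add_le_add hfull h0v)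

end Bound

/-! ## §3 Summation by parts in the co-moving orientation -/

section ByParts

variable {Q H₁ H₂ : Pt → ℝ} {c : ℝ} (x y a : Pt)

/-- [folklore] **SUMMATION BY PARTS (co-moving orientation)**: if the four pieces are summable,
`Σ'_w Q(w)·c·H₁(w+x)·[H₂(w+y+a) − H₂(w+y)] = Σ'_w Q(w−a)·c·[H₁(w+x−a) − H₁(w+x)]·H₂(w+y) + Σ'_w [Q(w−a) − Q(w)]·c·H₁(w+x)·H₂(w+y)`
(moving the step `a` of the second leg costs a step `−a` on the first leg plus a differenced weight). -/
theorem tsum_byParts'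
    (hS1 : Summable fun w : Pt => Q w * (c * (H₁ (w + x) * H₂ (w + (y + a)))))
    (hS2 : Summable fun w : Pt => Q w * (c * (H₁ (w + x) * H₂ (w + y))))
    (hS3 : Summable fun w : Pt => Q (w - a) * (c * ((H₁ (w + x - a) - H₁ (w + x)) * H₂ (w + y))))
    (hS4 : Summable fun w : Pt => (Q (w - a) - Q w) * (c * (H₁ (w + x) * H₂ (w + y)))) :
    ∑' w : Pt, Q w * (c * (H₁ (w + x) * (H₂ (w + (y + a)) - H₂ (w + y)))) =
      (∑' w : Pt, Q (w - a) * (c * ((H₁ (w + x - a) - H₁ (w + x)) * H₂ (w + y))))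
        + ∑' w : Pt, (Q (w - a) - Q w) * (c * (H₁ (w + x) * H₂ (w + y))) := by
  -- reflect the first leg: `H₁ (w + x) = G ((−x) − w)` with `G u = H₁ (−u)`; `G ((−x) + a − w) = H₁ (w + x − a)`
  have e1 : ∀ w : Pt, H₁ (w + x) = (fun u => H₁ (-u)) (-x - w) := fun w => apply_add_eq_reflect H₁ w x
  have e2 : ∀ w : Pt, H₁ (w + x - a) = (fun u => H₁ (-u)) (-x + a - w) := fun w => by
    simp only
    congr 1
    abel
  have h := tsum_byParts (Q := Q) (H₁ := fun u => H₁ (-u)) (H₂ := H₂) (c := c) (-x) y a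
    (by refine hS1.congr fun w => ?_; rw [e1])
    (by refine hS2.congr fun w => ?_; rw [e1])
    (by refine hS3.congr fun w => ?_; rw [e1, e2])
    (by refine hS4.congr fun w => ?_; rw [e1])
  simp only [e1, e2]
  exact h

end ByParts

end Summit.QuantumFields.BalabanUV.Beta.D1BFx.TwoPointTermBound

end
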